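import Literature.NumberTheory.EllipticCurves.TwoDescentTwoTorsionCharacter
import Literature.NumberTheory.EllipticCurves.TwoDescentOneRoot
import HarnessLib

/-!
# The character `χ_θ : E[2] → μ₂` of ONE rational `2`-torsion point and `H¹(χ_θ) : H¹(K, E[2]) → H¹(K, μ₂)`

The cohomological companion of `TwoDescentOneRoot.lean` (Cassels, *Lectures on Elliptic Curves*, LMSST 24,
§15: the `2`-descent attached to ONE root `θ` of the `2`-division cubic) and the one-root twin of
`TwoDescentTwoTorsionCharacter.lean` (which assumes SPLIT `2`-torsion `e₁, e₂, e₃ ∈ K`). For an elliptic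
curve `E/K` (`char K = 0`) and `θ ∈ K` with `Ψ₂(θ) = 0` (`WeierstrassCurve.Affine.IsTwoTorsionX`, i.e. ONE
`K`-rational `2`-torsion point `T_θ = (θ, −(a₁θ + a₃)/2)`; the other two need not be rational):

* `isTwoTorsionX_baseChange` — `Ψ₂(θ) = 0` persists along any extension; `exists_splitTwoTorsion_of_isTwoTorsionX`
  — over an ALGEBRAICALLY CLOSED field one root splits the `2`-division cubic
  (`Ψ₂/4 = (x − θ)(x² + ux + v)`, `u = θ + b₂/4`, `v = θ² + (b₂/4)θ + b₄/2`, and the quadratic factors);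
* `geomOneRoot h : E(K̄)` — the point `T_θ`, a non-zero element of `E[2] = geomTorsion W 2` fixed by `Γ_K`
  (`geomOneRoot_mem`, `geomOneRoot_ne_zero`, `smul_geomOneRoot`);
* `exists_geomTwoTorsion_eq` — **`E[2](K̄) = {O, T_θ, T₂, T₃}`** with `T_θ + T₂ = T₃`, all distinct
  (Silverman AEC Cor. III.6.4 / Prop. X.1.4, read over `K̄` where the cubic splits);
* `oneRootChar h : E[2] →+ μ₂` — the quadratic character `χ_θ = e₂(·, T_θ)`: `1` on `{O, T_θ}`, `−1` on
  `{T₂, T₃}`; additive (`E[2]/⟨T_θ⟩ ≅ ℤ/2`) and `Γ_K`-equivariant (`oneRootChar_smul`: `Γ_K` fixes `T_θ`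
  and `±1`); `oneRootChar_eq_zero_iff` — its kernel is `{O, T_θ}`;
* `oneRootCharH1 h : H¹(K, E[2]) →+ H¹(K, μ₂)` — the induced map on continuous cohomology
  (Mathlib's `ContinuousCohomology.map` along `id_{Γ_K}`), on cocycles `[φ] ↦ [χ_θ ∘ φ]`
  (`oneRootCharH1_oneCocycleClass`), and **`apply_eq_zero_or_eq_of_oneRootCharH1_eq_zero`**: if
  `H¹(χ_θ)[φ] = 0` then EVERY value `φ(σ)` lies in `{O, T_θ}` (coboundaries of `μ₂` vanish, `Γ_K` acting
  trivially on `±1`).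

`H¹(χ_θ)` alone is NOT injective on `H¹(K, E[2])` (its kernel is the image of `H¹(K, ⟨T_θ⟩)`); composed
with Kummer theory `H¹(K, μ₂) ≃ Kˣ/Kˣ²` it is the cohomological form of Cassels' one-root map
`P ↦ x(P) − θ`, and for a curve over a subfield `k ⊂ K = k(θ)` with `E(k)[2] = 0` the composite
`H¹(k, E[2]) → H¹(K, E[2]) → H¹(K, μ₂)` IS injective (sequel `TwoDescentOneRootH1Injective.lean`) — the
cohomological input of the general `2`-descent over the cubic `2`-division field. Definitions with bodies
and theorems only; no named fact, no `sorry`. Seat `bsd-line-spt-p1` (g28), towards the `2`-Selmer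
upgrade of the kernel `2`-descent certificates (`Ш(E/ℚ)[2] = 0` for curves with irreducible `E[2]`).

## References

* [Cassels1991LecturesEllipticCurves] J. W. S. Cassels, *Lectures on Elliptic Curves*, LMSST 24, CUP 1991,
  §15 (pp. 42–44: the one-root / no-root `2`-descent through `ℚ[Θ]`).
* [SilvermanAEC2009] J. H. Silverman, *The Arithmetic of Elliptic Curves*, 2nd ed., GTM 106 (2009),
  Cor. III.6.4, Prop. III.2.3, Thm. X.1.1, Prop. X.1.4.
* [SerreGaloisCohomology1997] J.-P. Serre, *Galois Cohomology*, Springer 1997, I.§2.2–2.4, II.§1.2.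
-/

noncomputable section

open scoped Classical

universe u

/-! ### One root of `Ψ₂` along a field extension; splitting over an algebraically closed field -/

namespace WeierstrassCurve.Affine.IsTwoTorsionX

variable {F : Type*} [Field F]

/-- **One root of the `2`-division cubic splits it over an algebraically closed field**: if
`Ψ₂(e) = 0` then `Ψ₂ = 4(x − e)(x − e₂)(x − e₃)` for some `e₂, e₃` (the roots of the quadratic
cofactor `x² + (e + b₂/4)x + (e² + (b₂/4)e + b₄/2)`). [cite: SilvermanAEC2009, Prop. III.2.3 and Cor. III.6.4] -/
theorem exists_splitTwoTorsion [CharZero F] [IsAlgClosed F] {V : Affine F} {e : F}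
    (h : V.IsTwoTorsionX e) : ∃ e₂ e₃ : F, V.SplitTwoTorsion e e₂ e₃ := by
  set u : F := e + V.b₂ / 4 with hu
  set v : F := e ^ 2 + V.b₂ / 4 * e + V.b₄ / 2 with hv
  obtain ⟨δ, hδ⟩ := IsAlgClosed.exists_eq_mul_self (u ^ 2 - 4 * v)
  have hΨ := h.eq
  refine ⟨(-u + δ) / 2, (-u - δ) / 2, ⟨?_, ?_, ?_⟩⟩
  · rw [hu]; ring
  · rw [hu] at hδ; rw [hv] at hδ
    linear_combination (-(1 : F) / 2) * hδ
  · rw [hu] at hδ; rw [hv] at hδ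
    linear_combination e * hδ + hΨ

end WeierstrassCurve.Affine.IsTwoTorsionX

namespace WeierstrassCurve

open Literature.NumberTheory.GaloisRepresentations Literature.NumberTheory.EllipticCurves Field
open WeierstrassCurve.Affine

variable {K : Type u} [Field K] [CharZero K] (W : WeierstrassCurve K) [W.IsElliptic] {θ : K}

omit [CharZero K] [W.IsElliptic] in
/-- **A root of `Ψ₂` stays a root along a field extension** `L/K` (the `bᵢ` of `W.baseChange L` are the
images of the `bᵢ`). [cite: SilvermanAEC2009, III.§1 (p. 42) and Prop. III.2.3] -/
theorem isTwoTorsionX_baseChange (h : W.toAffine.IsTwoTorsionX θ) (L : Type*) [Field L] [Algebra K L] :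
    (W.baseChange L).toAffine.IsTwoTorsionX (algebraMap K L θ) := by
  refine ⟨?_⟩
  have h' := congrArg (algebraMap K L) h.eq
  simp only [map_add, map_mul, map_pow, map_ofNat, map_zero] at h'
  change 4 * algebraMap K L θ ^ 3 + (W.map (algebraMap K L)).b₂ * algebraMap K L θ ^ 2 +
    2 * (W.map (algebraMap K L)).b₄ * algebraMap K L θ + (W.map (algebraMap K L)).b₆ = 0
  rw [map_b₂, map_b₄, map_b₆]
  exact h'

/-! ### The rational `2`-torsion point `T_θ` as a geometric point -/

/-- `T_θ = (θ, −(a₁θ + a₃)/2)` is a nonsingular point of `E/K̄`. [cite: SilvermanAEC2009, Prop. III.2.3] -/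
theorem nonsingular_geomOneRoot (h : W.toAffine.IsTwoTorsionX θ) :
    (W.baseChange (AlgebraicClosure K)).toAffine.Nonsingular (algebraMap K (AlgebraicClosure K) θ)
      ((W.baseChange (AlgebraicClosure K)).toAffine.twoTorsionY
        (algebraMap K (AlgebraicClosure K) θ)) := by
  haveI := W.isElliptic_baseChange (AlgebraicClosure K)
  exact (W.isTwoTorsionX_baseChange h (AlgebraicClosure K)).nonsingular_twoTorsion

/-- The `K`-rational `2`-torsion point `T_θ = (θ, −(a₁θ + a₃)/2)` as a point of `E(K̄)`.
[cite: Cassels1991LecturesEllipticCurves, §15 (the root θ of F)] -/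
def geomOneRoot (h : W.toAffine.IsTwoTorsionX θ) : geomPoints W :=
  Affine.Point.some _ _ (W.nonsingular_geomOneRoot h)

/-- `T_θ ∈ E[2]` (`T_θ + T_θ = O`: it is the fixed point of `y ↦ −y − a₁x − a₃`).
[cite: SilvermanAEC2009, Prop. III.2.3] -/
theorem geomOneRoot_mem (h : W.toAffine.IsTwoTorsionX θ) : W.geomOneRoot h ∈ geomTorsion W 2 := by
  rw [mem_geomTorsion_iff, two_zsmul]
  exact Affine.Point.add_self_of_Y_eq (Affine.negY_twoTorsionY _).symm

/-- `T_θ ≠ O` (an affine point). [cite: SilvermanAEC2009, Prop. III.2.3] -/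
theorem geomOneRoot_ne_zero (h : W.toAffine.IsTwoTorsionX θ) : W.geomOneRoot h ≠ 0 :=
  Affine.Point.some_ne_zero _

/-- `Γ_K` fixes `T_θ` (its coordinates lie in `K`). [cite: SilvermanAEC2009, Prop. X.1.4] -/
theorem smul_geomOneRoot (h : W.toAffine.IsTwoTorsionX θ) (σ : absoluteGaloisGroup K) :
    σ • W.geomOneRoot h = W.geomOneRoot h := by
  set τ : AlgebraicClosure K ≃ₐ[K] AlgebraicClosure K := σ
  show Affine.Point.map (W' := W) (τ : AlgebraicClosure K →ₐ[K] AlgebraicClosure K)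
    (W.geomOneRoot h) = W.geomOneRoot h
  unfold geomOneRoot
  rw [Affine.Point.map_some]
  simp only [Affine.Point.some.injEq, AlgEquiv.coe_toAlgHom]
  refine ⟨τ.commutes θ, ?_⟩
  simp only [twoTorsionY, baseChange, map_a₁, map_a₃, map_neg, map_div₀, map_add, map_mul,
    map_ofNat, AlgEquiv.commutes]

/-- The `x`-coordinate of `T_θ` is `θ`: a geometric point `(x, y)` equals `T_θ` iff `x = θ`
(then `y = −(a₁θ + a₃)/2` is forced). [cite: SilvermanAEC2009, Prop. III.2.3] -/
theorem some_eq_geomOneRoot_iff (h : W.toAffine.IsTwoTorsionX θ) {x y : AlgebraicClosure K}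
    (hxy : (W.baseChange (AlgebraicClosure K)).toAffine.Nonsingular x y) :
    (Affine.Point.some x y hxy : geomPoints W) = W.geomOneRoot h ↔
      x = algebraMap K (AlgebraicClosure K) θ := by
  constructor
  · intro heq
    exact (Affine.Point.some.inj heq).1
  · rintro rfl
    haveI := W.isElliptic_baseChange (AlgebraicClosure K)
    have hy := Affine.eq_twoTorsionY_of_isTwoTorsionX (W.isTwoTorsionX_baseChange h _) hxy
    subst hy
    rfl

/-! ### `E[2](K̄) = {O, T_θ, T₂, T₃}` -/

/-- **`E[2] = {O, T_θ, T₂, T₃}`, a group of order `4` with `T_θ + T₂ = T₃`**: over `K̄` the `2`-division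
cubic splits with first root `θ` (`exists_splitTwoTorsion`), and the three `2`-torsion points are distinct
(`Δ ≠ 0`). [cite: SilvermanAEC2009, Cor. III.6.4 and Prop. X.1.4] -/
theorem exists_geomTwoTorsion_eq (h : W.toAffine.IsTwoTorsionX θ) :
    ∃ T₂ T₃ : geomPoints W, T₂ ∈ geomTorsion W 2 ∧ T₃ ∈ geomTorsion W 2 ∧ T₂ ≠ 0 ∧ T₃ ≠ 0 ∧
      T₂ ≠ W.geomOneRoot h ∧ T₃ ≠ W.geomOneRoot h ∧ T₂ ≠ T₃ ∧
      W.geomOneRoot h + T₂ = T₃ ∧ T₂ + T₂ = 0 ∧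
      ∀ P ∈ geomTorsion W 2, P = 0 ∨ P = W.geomOneRoot h ∨ P = T₂ ∨ P = T₃ := by
  haveI := W.isElliptic_baseChange (AlgebraicClosure K)
  obtain ⟨e₂, e₃, hs⟩ := (W.isTwoTorsionX_baseChange h (AlgebraicClosure K)).exists_splitTwoTorsion
  have hT : W.geomOneRoot h = Affine.Point.some _ _ (Affine.nonsingular_twoTorsion hs) := rfl
  refine ⟨Affine.Point.some _ _ (Affine.nonsingular_twoTorsion hs.swap₁₂),
    Affine.Point.some _ _ (Affine.nonsingular_twoTorsion hs.swap₂₃.swap₁₂), ?_, ?_,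
    Affine.Point.some_ne_zero _, Affine.Point.some_ne_zero _, ?_, ?_, ?_, ?_, ?_, ?_⟩
  · rw [mem_geomTorsion_iff]; exact Affine.Point.two_zsmul_twoTorsion hs.swap₁₂
  · rw [mem_geomTorsion_iff]; exact Affine.Point.two_zsmul_twoTorsion hs.swap₂₃.swap₁₂
  · rw [hT]; intro heq
    exact hs.ne₁₂ (Affine.Point.some.inj heq).1.symm
  · rw [hT]; intro heq
    exact hs.ne₁₃ (Affine.Point.some.inj heq).1.symm
  · intro heq
    exact hs.ne₂₃ (Affine.Point.some.inj heq).1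
  · rw [hT]; exact Affine.Point.twoTorsion_add_twoTorsion hs
  · exact Affine.Point.twoTorsion_add_self hs.swap₁₂
  · intro P hP
    rw [mem_geomTorsion_iff] at hP
    have hP' : (2 : ℕ) • P = 0 := by rw [two_nsmul, ← two_zsmul]; exact hP
    rw [hT]
    exact Affine.Point.eq_zero_or_eq_twoTorsion_of_two_nsmul_eq_zero hs hP'

/-! ### The character `χ_θ : E[2] → μ₂` -/

/-- The quadratic character of `E[2]` attached to the rational `2`-torsion point `T_θ`:
`χ_θ(O) = χ_θ(T_θ) = 1`, `χ_θ = −1` on the other two points (the Weil pairing `e₂(·, T_θ)`), as a map into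
the carrier of the Galois module `μ₂ = μ₂(K̄)`. [cite: SilvermanAEC2009, Thm. X.1.1, Prop. X.1.4] -/
def oneRootCharFun (h : W.toAffine.IsTwoTorsionX θ) (P : geomTorsion W 2) :
    DiscreteGaloisModule.MuCarrier K 2 :=
  DiscreteGaloisModule.MuCarrier.ofRootsOfUnity
    ⟨if (P : geomPoints W) = 0 ∨ (P : geomPoints W) = W.geomOneRoot h then 1 else -1, by
      split_ifs <;> simp [mem_rootsOfUnity]⟩

/-- The value of `χ_θ` as a unit of `K̄`: `1` on `{O, T_θ}`, `-1` otherwise. [cite: SilvermanAEC2009, Thm. X.1.1] -/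
theorem muVal_oneRootCharFun (h : W.toAffine.IsTwoTorsionX θ) (P : geomTorsion W 2) :
    muVal K 2 (W.oneRootCharFun h P) =
      if (P : geomPoints W) = 0 ∨ (P : geomPoints W) = W.geomOneRoot h then 1 else -1 :=
  rfl

/-- `χ_θ` is additive (`E[2] = {O, T_θ, T₂, T₃}` with `T_θ + T₂ = T₃`: the quotient `E[2]/⟨T_θ⟩ ≅ ℤ/2`).
[cite: SilvermanAEC2009, Thm. X.1.1] -/
theorem oneRootCharFun_add (h : W.toAffine.IsTwoTorsionX θ) (P Q : geomTorsion W 2) :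
    W.oneRootCharFun h (P + Q) = W.oneRootCharFun h P + W.oneRootCharFun h Q := by
  apply muVal_injective K 2
  rw [muVal_add, muVal_oneRootCharFun, muVal_oneRootCharFun, muVal_oneRootCharFun, AddSubgroup.coe_add]
  obtain ⟨T₂, T₃, -, -, h20, h30, h21, h31, h23, t12, t22, hall⟩ := W.exists_geomTwoTorsion_eq h
  have h10 := W.geomOneRoot_ne_zero h
  have t11 : W.geomOneRoot h + W.geomOneRoot h = 0 := by
    have := W.geomOneRoot_mem h
    rw [mem_geomTorsion_iff, two_zsmul] at this
    exact this
  have t21 : T₂ + W.geomOneRoot h = T₃ := by rw [add_comm]; exact t12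
  have t13 : W.geomOneRoot h + T₃ = T₂ := by
    rw [← t12, ← add_assoc, t11, zero_add]
  have t31 : T₃ + W.geomOneRoot h = T₂ := by rw [add_comm]; exact t13
  have t23 : T₂ + T₃ = W.geomOneRoot h := by
    rw [← t12, add_comm (W.geomOneRoot h), ← add_assoc, t22, zero_add]
  have t32 : T₃ + T₂ = W.geomOneRoot h := by rw [add_comm]; exact t23
  have t33 : T₃ + T₃ = 0 := by
    rw [← t12, add_assoc, add_comm T₂ (W.geomOneRoot h + T₂), add_assoc, t22, add_zero, t11]
  rcases hall P P.2 with hP | hP | hP | hP <;>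
    rcases hall Q Q.2 with hQ | hQ | hQ | hQ <;>
    simp [hP, hQ, t12, t21, t13, t31, t23, t32, t11, t22, t33, h10, h20, h30, h21, h31]

/-- **The character `χ_θ : E[2] →+ μ₂`** (additive form, values in `MuCarrier K 2 = Additive μ₂(K̄)`).
[cite: SilvermanAEC2009, Thm. X.1.1, Prop. X.1.4] -/
def oneRootChar (h : W.toAffine.IsTwoTorsionX θ) :
    geomTorsion W 2 →+ DiscreteGaloisModule.MuCarrier K 2 :=
  AddMonoidHom.mk' (W.oneRootCharFun h) (W.oneRootCharFun_add h)

/-- Unfolding `oneRootChar`. [cite: SilvermanAEC2009, Thm. X.1.1] -/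
theorem oneRootChar_apply (h : W.toAffine.IsTwoTorsionX θ) (P : geomTorsion W 2) :
    W.oneRootChar h P = W.oneRootCharFun h P :=
  rfl

/-- **The kernel of `χ_θ` is `{O, T_θ}`** (`−1 ≠ 1` in characteristic `0`). [cite: SilvermanAEC2009, Thm. X.1.1] -/
theorem oneRootChar_eq_zero_iff (h : W.toAffine.IsTwoTorsionX θ) (P : geomTorsion W 2) :
    W.oneRootChar h P = 0 ↔ (P : geomPoints W) = 0 ∨ (P : geomPoints W) = W.geomOneRoot h := by
  constructor
  · intro h0
    have hv := congrArg (fun v => ((muVal K 2 v : (AlgebraicClosure K)ˣ) : AlgebraicClosure K)) h0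
    simp only [oneRootChar_apply, muVal_oneRootCharFun, muVal_zero, Units.val_one] at hv
    by_contra hne
    rw [if_neg hne] at hv
    simp only [Units.val_neg, Units.val_one] at hv
    have : (2 : AlgebraicClosure K) = 0 := by linear_combination -hv
    exact two_ne_zero this
  · intro hP
    apply muVal_injective K 2
    rw [oneRootChar_apply, muVal_oneRootCharFun, if_pos hP, muVal_zero]

/-- **`χ_θ` is `Γ_K`-equivariant**: `χ_θ(σ • P) = σ • χ_θ(P)` (both actions are trivial: `Γ_K` fixes the
rational point `T_θ`, hence the set `{O, T_θ}`, and fixes `±1`). [cite: SilvermanAEC2009, Thm. X.1.1] -/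
theorem oneRootChar_smul (h : W.toAffine.IsTwoTorsionX θ) (σ : absoluteGaloisGroup K)
    (P : geomTorsion W 2) :
    W.oneRootChar h (σ • P) = DiscreteGaloisModule.mu K 2 σ (W.oneRootChar h P) := by
  rw [mu_two_apply_eq, oneRootChar_apply, oneRootChar_apply]
  apply muVal_injective K 2
  rw [muVal_oneRootCharFun, muVal_oneRootCharFun,
    Literature.NumberTheory.EllipticCurves.AddSubgroup.torsionBy.coe_smul]
  have hiff : (σ • (P : geomPoints W) = 0 ∨ σ • (P : geomPoints W) = W.geomOneRoot h) ↔
      ((P : geomPoints W) = 0 ∨ (P : geomPoints W) = W.geomOneRoot h) := by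
    constructor
    · rintro (h0 | h1)
      · left
        have := congrArg (fun Q => σ⁻¹ • Q) h0
        simpa using this
      · right
        have := congrArg (fun Q => σ⁻¹ • Q) h1
        simpa [smul_geomOneRoot] using this
    · rintro (h0 | h1)
      · left; rw [h0, smul_zero]
      · right; rw [h1, smul_geomOneRoot]
  simp only [hiff]

/-! ### The induced map `H¹(χ_θ) : H¹(K, E[2]) → H¹(K, μ₂)` -/

/-- `χ_θ` as a morphism in Mathlib's category `TopRep ℤ Γ_K` (source `E[2]` with its discrete topology,
target the Galois module `μ₂`), in the shape consumed by `ContinuousCohomology.map` along `id : Γ_K → Γ_K`.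
[cite: SerreGaloisCohomology1997, I.§2.4] -/
def oneRootCharHom (h : W.toAffine.IsTwoTorsionX θ) :
    TopRep.res ((ContinuousMonoidHom.id (absoluteGaloisGroup K)) :
        absoluteGaloisGroup K →* absoluteGaloisGroup K)
        (discreteTopRep (absoluteGaloisGroup K) (geomTorsion W 2)) ⟶
      (DiscreteGaloisModule.mu K 2).toTopRep :=
  TopRep.ofHom
    { toLinearMap := (W.oneRootChar h).toIntLinearMap
      cont := continuous_of_discreteTopology
      isIntertwining' := fun σ ↦ by
        ext P
        exact W.oneRootChar_smul h σ P }

/-- Values of the morphism `oneRootCharHom`. [cite: SerreGaloisCohomology1997, I.§2.4] -/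
@[simp]
theorem oneRootCharHom_hom_apply (h : W.toAffine.IsTwoTorsionX θ) (P : geomTorsion W 2) :
    (W.oneRootCharHom h).hom P = W.oneRootChar h P :=
  rfl

/-- **`H¹(χ_θ) : H¹(K, E[2]) →+ H¹(K, μ₂)`**, the map on continuous cohomology induced by the
`Γ_K`-equivariant character `χ_θ : E[2] → μ₂`. Composed with Kummer theory `H¹(K, μ₂) ≃ Kˣ/Kˣ²` it is the
cohomological form of Cassels' one-root descent map `P ↦ x(P) − θ`.
[cite: Cassels1991LecturesEllipticCurves, §15 Lemma 1] [cite: SilvermanAEC2009, Thm. X.1.1] -/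
def oneRootCharH1 (h : W.toAffine.IsTwoTorsionX θ) : galH1Torsion W 2 →+ H1Mu K 2 :=
  (ContinuousCohomology.map (ContinuousMonoidHom.id (absoluteGaloisGroup K))
    (W.oneRootCharHom h) 1).hom.toLinearMap.toAddMonoidHom

/-- **`H¹(χ_θ)` on explicit cocycles**: the class of `φ : Γ_K → E[2]` goes to the class of `χ_θ ∘ φ`.
[cite: SerreGaloisCohomology1997, I.§2.4] -/
theorem oneRootCharH1_oneCocycleClass (h : W.toAffine.IsTwoTorsionX θ)
    (φ : contOneCocycles (discreteTopRep (absoluteGaloisGroup K) (geomTorsion W 2))) :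
    W.oneRootCharH1 h (oneCocycleClass _ φ) =
      oneCocycleClass _ (contOneCocycles.pullback (ContinuousMonoidHom.id (absoluteGaloisGroup K))
        (W.oneRootCharHom h) φ) := by
  unfold oneRootCharH1
  simp only [LinearMap.toAddMonoidHom_coe, ContinuousLinearMap.coe_coe]
  exact map_oneCocycleClass _ (ContinuousMonoidHom.id (absoluteGaloisGroup K)) (W.oneRootCharHom h) φ

/-- **A cocycle killed by `H¹(χ_θ)` takes values in `{O, T_θ}`**: if `H¹(χ_θ)[φ] = 0` then `χ_θ ∘ φ` is a
coboundary with values in `μ₂`, hence vanishes identically (`Γ_K` acts trivially on `±1`), so every value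
`φ(σ)` lies in the kernel `{O, T_θ}` of `χ_θ`. [cite: SilvermanAEC2009, Thm. X.1.1] [cite: SerreGaloisCohomology1997, I.§2.2] -/
theorem apply_eq_zero_or_eq_of_oneRootCharH1_eq_zero (h : W.toAffine.IsTwoTorsionX θ)
    (φ : contOneCocycles (discreteTopRep (absoluteGaloisGroup K) (geomTorsion W 2)))
    (h0 : W.oneRootCharH1 h (oneCocycleClass _ φ) = 0) (σ : absoluteGaloisGroup K) :
    ((φ.1 σ : geomTorsion W 2) : geomPoints W) = 0 ∨
      ((φ.1 σ : geomTorsion W 2) : geomPoints W) = W.geomOneRoot h := by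
  rw [oneRootCharH1_oneCocycleClass, oneCocycleClass_eq_zero_iff] at h0
  obtain ⟨v, hv⟩ := h0
  have hσ := hv σ
  rw [contOneCocycles.pullback_apply, oneRootCharHom_hom_apply] at hσ
  change W.oneRootChar h (φ.1 σ) = _ at hσ
  have hzero : W.oneRootChar h (φ.1 σ) = 0 := by
    rw [hσ]
    change DiscreteGaloisModule.mu K 2 σ v - v = 0
    rw [mu_two_apply_eq, sub_self]
  exact (W.oneRootChar_eq_zero_iff h _).mp hzero

end WeierstrassCurve

end
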